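import Summits.ResolutionOfSingularities.ResolutionOfSingularities.Theorems.WildConesCampaignW46ForcedAtomFibreCount
import Summits.ResolutionOfSingularities.ResolutionOfSingularities.Theorems.WildConesCampaignW46MilnorNumberBound
import Literature.AlgebraicGeometry.Resolution.AdicQuotient
import HarnessLib

/-!
# [OURS · L1 W4.6, rung (i) with FINITELY MANY singular points — brick 32] The measure `4^μ` of a forced-atom point:
# invariance under isomorphic germs, and the CENTRE INEQUALITY `Σ_{ξ′ ↦ ξ} 4^{μ(ξ′)} < 4^{μ(ξ)}` from a branching bound

Cell res-hironaka (LADDER-RESOLUTION rung L, D-0089), slot W4.6 «restricted regimes as rungs», seat res-L1-s46-pv-2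
(gen 5: the GEOMETRIC upgrade of the forced-atom rung — finitely many singular points instead of one). Host: route
`WildCones`, crux `ClassicalRegimes` (stmt-ResolutionOfSingularities-16884), `--supports … --as helper`.

HONEST FRAMING. Everything here is OURS: bookkeeping over this seat's bricks 23 (`sInf_mu_eq_of_presentation`: the
Milnor number of the POINT), 30/31 (canonical chart datum, fibre count) and route `WildCones`' calculus (`mu`, `step`,
`MuDrop`), and the tree's transport of adic completions along ring isomorphisms (`adicCompletionCongr`). NOTHING here
is a statement of H. Hironaka's manuscript [Hironaka2017] and nothing of it is used; no FACT-LIST premise. AI review is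
weaker than expert review.

## What is proved

* `sInf_mu_eq_of_ringEquiv` — the Milnor number of a presented germ `(R, I)` (the `sInf` over presentations
  `R̂ ≅ K⟦z,u⟧`, `I = (f₀)`, `f₀ ↦ unit · (z^p − ser c₀)` of `mu c₀`) is invariant under ring isomorphisms
  `e : R ≅ S`, `I ↦ e(I)`: presentations transport along `ê : R̂ ≅ Ŝ`. (Off the centre the germ of the transform IS the
  germ downstairs, so the measure does not change there.)
* `sum_pow_mu_lt_of_calculus` — **THE CENTRE INEQUALITY.** `K` algebraically closed, `0 < n`; a blow-up `π : Z′ → Z`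
  of an ambient datum at `D = {ξ}` over the same base field, `E = (J, p)`, `E′` its transform; `ξ` a forced-atom point
  (embedding dimension `n + 1`, a presentation, every presentation isolated) lying in `Sing(E)`; every point of
  `Sing(E′)` closed with every presentation isolated. Suppose the calculus in `n` variables satisfies: (ord) a state of
  multiplicity `p` with a forced successor has order `≥ p + 1`; (cnt) canonical forced successor data number at most
  `3`; (μ) the Milnor number drops at forced steps (`MuDrop`). Then for every finite set `t` of points of `Sing(E′)` over
  `ξ`: `Σ_{ξ′ ∈ t} 4^{μ(ξ′)} < 4^{μ(ξ)}` — at most three points (brick 31), each of Milnor number `≤ μ(ξ) − 1`.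

References: this seat's bricks 23, 27–31; H. Hironaka, ms. 2017, Th. 16.6 p.84 — ROLE of «Eq. (127): the invariant
drops at the closed points over the centre» only, replaced here by the fibre sum of `4^μ`; under adjudication, not
cited as fact. [folklore]
-/

noncomputable section

-- single-problem summit: the doubled namespace component `ResolutionOfSingularities` is forced
set_option linter.dupNamespace false

open scoped BigOperators Classical
open MvPowerSeries IsLocalRing

namespace Summit.ResolutionOfSingularities.ResolutionOfSingularities.Theorems

namespace CampaignW46.ForcedAtom

open CategoryTheory AlgebraicGeometry TopologicalSpace
open Literature.AlgebraicGeometry.Resolution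
open Literature.AlgebraicGeometry.Hironaka2017.S02Preliminaries
open Literature.AlgebraicGeometry.Hironaka2017.Datum
open Scheme.IdealSheafData
open WildCones
open CampaignW46.ChartPoint CampaignW46.AtomGerm CampaignW46.FormalChart

variable {p : ℕ} [Fact p.Prime] {K : Type} [Field K] [CharP K p] {n : ℕ}

/-! ## Invariance of the Milnor number of the point under isomorphic germs -/

omit [Fact p.Prime] [CharP K p] in
/-- A ring isomorphism of local rings maps the maximal ideal onto the maximal ideal. [folklore] -/
theorem map_maximalIdeal_of_ringEquiv {R S : Type} [CommRing R] [IsLocalRing R] [CommRing S] [IsLocalRing S]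
    (e : R ≃+* S) : (maximalIdeal R).map e.toRingHom = maximalIdeal S := by
  rw [RingEquiv.toRingHom_eq_coe, Ideal.map_comap_of_equiv]
  ext x
  rw [Ideal.mem_comap, IsLocalRing.mem_maximalIdeal, IsLocalRing.mem_maximalIdeal, mem_nonunits_iff,
    mem_nonunits_iff]
  exact (MulEquiv.isUnit_map e.symm).not

omit [Fact p.Prime] [CharP K p] in
/-- **Presentations transport along isomorphic germs**, one direction: a presentation of `(R, I)` gives one of
`(S, e(I))` with the same coefficient function. [folklore] -/
theorem exists_presentation_of_ringEquiv {R S : Type} [CommRing R] [IsLocalRing R] [CommRing S] [IsLocalRing S]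
    (e : R ≃+* S) (I : Ideal R)
    (E₀ : AdicCompletion (maximalIdeal R) R ≃+* MvPowerSeries (Option (Fin n)) K) (f₀ : R) (c₀ : (Fin n → ℕ) → K)
    (w₀ : MvPowerSeries (Option (Fin n)) K) (hJ : I = Ideal.span {f₀})
    (hf : E₀ (algebraMap _ _ f₀) = w₀ * ((X none : MvPowerSeries (Option (Fin n)) K) ^ p -
      rename (some : Fin n → Option (Fin n)) (ser p n K c₀))) :
    ∃ (E₀' : AdicCompletion (maximalIdeal S) S ≃+* MvPowerSeries (Option (Fin n)) K) (f₀' : S),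
      I.map e = Ideal.span {f₀'} ∧
      E₀' (algebraMap _ _ f₀') = w₀ * ((X none : MvPowerSeries (Option (Fin n)) K) ^ p -
        rename (some : Fin n → Option (Fin n)) (ser p n K c₀)) := by
  set ê := adicCompletionCongr (maximalIdeal R) (maximalIdeal S) e (map_maximalIdeal_of_ringEquiv e) with hê
  refine ⟨ê.symm.trans E₀, e f₀, ?_, ?_⟩
  · rw [hJ, Ideal.map_span, Set.image_singleton]
  · have h1 : ê (algebraMap R (AdicCompletion (maximalIdeal R) R) f₀) = algebraMap S _ (e f₀) := by
      rw [hê]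
      exact adicCompletionMap_algebraMap e.toRingHom (map_maximalIdeal_of_ringEquiv e).le f₀
    rw [RingEquiv.trans_apply, ← h1, RingEquiv.symm_apply_apply, hf]

omit [Fact p.Prime] [CharP K p] in
/-- [OURS · L1 W4.6 — the Milnor number of the POINT is an invariant of the germ; NOT a statement of the manuscript] For a
ring isomorphism `e : R ≅ S` of local rings, the `sInf` of `mu c₀` over presentations of `(R, I)` equals that over
presentations of `(S, e(I))`. [folklore] -/
theorem sInf_mu_eq_of_ringEquiv {R S : Type} [CommRing R] [IsLocalRing R] [CommRing S] [IsLocalRing S]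
    (e : R ≃+* S) (I : Ideal R) :
    sInf {m : ℕ | ∃ (E₀ : AdicCompletion (maximalIdeal R) R ≃+* MvPowerSeries (Option (Fin n)) K) (f₀ : R)
        (c₀ : (Fin n → ℕ) → K) (w₀ : MvPowerSeries (Option (Fin n)) K),
        I = Ideal.span {f₀} ∧ IsUnit w₀ ∧ E₀ (algebraMap _ _ f₀) = w₀ *
          ((X none : MvPowerSeries (Option (Fin n)) K) ^ p - rename (some : Fin n → Option (Fin n)) (ser p n K c₀)) ∧
        m = mu p n K c₀} =
    sInf {m : ℕ | ∃ (E₀ : AdicCompletion (maximalIdeal S) S ≃+* MvPowerSeries (Option (Fin n)) K) (f₀ : S)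
        (c₀ : (Fin n → ℕ) → K) (w₀ : MvPowerSeries (Option (Fin n)) K),
        I.map e = Ideal.span {f₀} ∧ IsUnit w₀ ∧ E₀ (algebraMap _ _ f₀) = w₀ *
          ((X none : MvPowerSeries (Option (Fin n)) K) ^ p - rename (some : Fin n → Option (Fin n)) (ser p n K c₀)) ∧
        m = mu p n K c₀} := by
  congr 1
  ext m
  constructor
  · rintro ⟨E₀, f₀, c₀, w₀, hJ, hw, hf, rfl⟩
    obtain ⟨E₀', f₀', hJ', hf'⟩ := exists_presentation_of_ringEquiv e I E₀ f₀ c₀ w₀ hJ hf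
    exact ⟨E₀', f₀', c₀, w₀, hJ', hw, hf', rfl⟩
  · rintro ⟨E₀', f₀', c₀, w₀, hJ', hw, hf', rfl⟩
    obtain ⟨E₀, f₀, hJ, hf⟩ := exists_presentation_of_ringEquiv e.symm (I.map e) E₀' f₀' c₀ w₀ hJ' hf'
    refine ⟨E₀, f₀, c₀, w₀, ?_, hw, hf, rfl⟩
    -- `e⁻¹(e(I)) = I` (tree: `FInjectiveMacaulayfication.TwoLevelRoadFrame.map_map_symm`, not imported)
    have hII : (I.map e).map e.symm = I := by
      ext x
      conv_lhs => rw [← e.symm_apply_apply x]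
      rw [Ideal.apply_mem_of_equiv_iff, Ideal.apply_mem_of_equiv_iff]
    rw [← hJ, hII]

/-! ## The centre inequality from a branching bound of the calculus -/

variable [IsAlgClosed K]

/-- [OURS · L1 W4.6 rung (i), finitely many singular points — THE CENTRE INEQUALITY; replaces the role of Eq. (127) of
Th. 16.6 (H. Hironaka, ms. 2017, p.84 l.10–20: the invariant drops at the closed points over the centre) by the FIBRE
SUM of `4^μ` over the singular points above a blown-up forced-atom point; NOT a statement of the manuscript] See the
module docstring. The measure at a point is `4 ^ (sInf over presentations of mu)` (`0`-free: at a presented point it is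
`4^{μ}` with `μ` the Milnor number of the point, brick 23). [folklore] -/
theorem sum_pow_mu_lt_of_calculus (hn : 0 < n)
    (hord : ∀ (a : (Fin n → ℕ) → K) (i : Fin n) (τ : Fin n → K), MultP p n K a →
      Isol p n K (step p n K i τ a) → MultP p n K (step p n K i τ a) →
        ser p n K a ∈ maximalIdeal (MvPowerSeries (Fin n) K) ^ (p + 1))
    (hcnt : ∀ (a : (Fin n → ℕ) → K), MultP p n K a → ∀ T : Finset (Fin n × (Fin n → K)),
      (∀ d ∈ T, Isol p n K (step p n K d.1 d.2 a) ∧ MultP p n K (step p n K d.1 d.2 a) ∧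
        ∀ l : Fin n, l ≤ d.1 → d.2 l = 0) → T.card ≤ 3)
    (hmu : MuDrop p n K)
    {A A' : AmbientDatum p K} (π : A'.Z ⟶ A.Z) (D : Closeds A.Z)
    (hπ : IsBlowup π (vanishingIdeal D)) (hhom : A'.hom = π ≫ A.hom) {E : IdealExponent A.Z} (hb : E.b = p)
    {ξ : A.Z} (hD : (D : Set A.Z) = {ξ}) (hξ : ξ ∈ E.sing)
    (hd : (maximalIdeal (A.Z.presheaf.stalk ξ)).spanFinrank = n + 1)
    (hex : ∃ (E₀ : AdicCompletion (maximalIdeal (A.Z.presheaf.stalk ξ)) (A.Z.presheaf.stalk ξ) ≃+*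
        MvPowerSeries (Option (Fin n)) K)
      (f₀ : A.Z.presheaf.stalk ξ) (c₀ : (Fin n → ℕ) → K) (w₀ : MvPowerSeries (Option (Fin n)) K),
      stalkIdeal E.J ξ = Ideal.span {f₀} ∧ IsUnit w₀ ∧
        E₀ (algebraMap _ _ f₀) = w₀ * ((X none : MvPowerSeries (Option (Fin n)) K) ^ p -
          rename (some : Fin n → Option (Fin n)) (ser p n K c₀)))
    (hall : ∀ (E₀ : AdicCompletion (maximalIdeal (A.Z.presheaf.stalk ξ)) (A.Z.presheaf.stalk ξ) ≃+*
        MvPowerSeries (Option (Fin n)) K)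
      (f₀ : A.Z.presheaf.stalk ξ) (c₀ : (Fin n → ℕ) → K) (w₀ : MvPowerSeries (Option (Fin n)) K),
      stalkIdeal E.J ξ = Ideal.span {f₀} → IsUnit w₀ →
        E₀ (algebraMap _ _ f₀) = w₀ * ((X none : MvPowerSeries (Option (Fin n)) K) ^ p -
          rename (some : Fin n → Option (Fin n)) (ser p n K c₀)) → Isol p n K c₀)
    (hiso' : ∀ ξ' ∈ (E.transform π D).sing, IsClosed ({ξ'} : Set A'.Z) ∧
      ∀ (E₀' : AdicCompletion (maximalIdeal (A'.Z.presheaf.stalk ξ')) (A'.Z.presheaf.stalk ξ') ≃+*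
          MvPowerSeries (Option (Fin n)) K)
        (f₀' : A'.Z.presheaf.stalk ξ') (c' : (Fin n → ℕ) → K) (w' : MvPowerSeries (Option (Fin n)) K),
        stalkIdeal (E.transform π D).J ξ' = Ideal.span {f₀'} → IsUnit w' →
          E₀' (algebraMap _ _ f₀') = w' * ((X none : MvPowerSeries (Option (Fin n)) K) ^ p -
            rename (some : Fin n → Option (Fin n)) (ser p n K c')) → Isol p n K c')
    (t : Finset A'.Z) (ht : ∀ ξ' ∈ t, ξ' ∈ (E.transform π D).sing ∧ π ξ' = ξ) :
    t.sum (fun ξ' => 4 ^ sInf {m : ℕ | ∃ (E₀' : AdicCompletion (maximalIdeal (A'.Z.presheaf.stalk ξ'))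
        (A'.Z.presheaf.stalk ξ') ≃+* MvPowerSeries (Option (Fin n)) K)
        (f₀' : A'.Z.presheaf.stalk ξ') (c' : (Fin n → ℕ) → K) (w' : MvPowerSeries (Option (Fin n)) K),
        stalkIdeal (E.transform π D).J ξ' = Ideal.span {f₀'} ∧ IsUnit w' ∧
          E₀' (algebraMap _ _ f₀') = w' * ((X none : MvPowerSeries (Option (Fin n)) K) ^ p -
            rename (some : Fin n → Option (Fin n)) (ser p n K c')) ∧ m = mu p n K c'}) <
      4 ^ sInf {m : ℕ | ∃ (E₀ : AdicCompletion (maximalIdeal (A.Z.presheaf.stalk ξ)) (A.Z.presheaf.stalk ξ) ≃+*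
          MvPowerSeries (Option (Fin n)) K)
        (f₀ : A.Z.presheaf.stalk ξ) (c₀ : (Fin n → ℕ) → K) (w₀ : MvPowerSeries (Option (Fin n)) K),
        stalkIdeal E.J ξ = Ideal.span {f₀} ∧ IsUnit w₀ ∧
          E₀ (algebraMap _ _ f₀) = w₀ * ((X none : MvPowerSeries (Option (Fin n)) K) ^ p -
            rename (some : Fin n → Option (Fin n)) (ser p n K c₀)) ∧ m = mu p n K c₀} := by
  haveI : PerfectRing K p := PerfectField.toPerfectRing p
  haveI : IsLocallyNoetherian A'.Z := ambient_isLocallyNoetherian A'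
  haveI : IsRegularLocalRing (A.Z.presheaf.stalk ξ) := ambient_isRegular A _
  have hp : p.Prime := Fact.out
  obtain ⟨E₀, f₀, a, w, hJ, hw, hf₀⟩ := hex
  have hI : Isol p n K a := hall E₀ f₀ a w hJ hw hf₀
  -- multiplicity `p` of the atom at `ξ ∈ Sing(E)`
  have hM : MultP p n K a := by
    have hf₀𝔪 : f₀ ∈ maximalIdeal (A.Z.presheaf.stalk ξ) ^ p := by
      have h := hξ
      change (E.b : ℕ∞) ≤ idealOrder E.J _ at h
      rw [le_idealOrder_iff, hJ, Ideal.span_singleton_le_iff_mem, hb] at h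
      exact h
    exact (transform_mem_pow_iff_multP E₀ hw a hf₀).2.mpr ⟨ThreefoldsCharTwo.ser_ne_zero_of_isol hn hI, hf₀𝔪⟩
  -- the measure at `ξ` is `4^{μ(a)}`
  rw [sInf_mu_eq_of_presentation E ξ E₀ f₀ a w hJ hw hf₀]
  -- empty fibre: nothing to prove
  rcases t.eq_empty_or_nonempty with rfl | ⟨ξ₀, hξ₀⟩
  · rw [Finset.sum_empty]; exact pow_pos (by norm_num) _
  -- a singular point over `ξ` exists: the atom has order `≥ p + 1`
  obtain ⟨hξ₀S, hξ₀⟩ := ht ξ₀ hξ₀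
  subst hξ₀
  have hord' : ser p n K a ∈ maximalIdeal (MvPowerSeries (Fin n) K) ^ (p + 1) := by
    obtain ⟨i, τ, E₀', f₀', w', hJ', hw', hf'⟩ := exists_presentation_transform_of_eq π D hπ hhom hb hD hd E₀ f₀ a w
      hJ hw hf₀ hM hξ₀S (hiso' ξ₀ hξ₀S).1
    haveI : IsRegularLocalRing (A'.Z.presheaf.stalk ξ₀) := ambient_isRegular A' _
    have hI' : Isol p n K (step p n K i τ a) := (hiso' ξ₀ hξ₀S).2 E₀' f₀' _ w' hJ' hw' hf'
    have hM' : MultP p n K (step p n K i τ a) := by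
      have hf'𝔪 : f₀' ∈ maximalIdeal (A'.Z.presheaf.stalk ξ₀) ^ p := by
        have h := hξ₀S
        change ((E.transform π D).b : ℕ∞) ≤ idealOrder (E.transform π D).J _ at h
        rw [le_idealOrder_iff, hJ', Ideal.span_singleton_le_iff_mem] at h
        have hb' : (E.transform π D).b = p := hb
        rw [hb'] at h
        exact h
      exact (transform_mem_pow_iff_multP E₀' hw' _ hf').2.mpr ⟨ThreefoldsCharTwo.ser_ne_zero_of_isol hn hI', hf'𝔪⟩
    exact hord a i τ hM hI' hM'
  -- at most three points over `ξ` (brick 31 with the branching bound)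
  have hcard : t.card ≤ 3 :=
    card_fibre_le_of_calculusBound hn π D hπ hhom hb hD hd E₀ f₀ a w hJ hw hf₀ hM hord' hiso' 3 (hcnt a hM) t ht
  -- each point has Milnor number `≤ μ(a) − 1` (canonical datum, brick 30, and the Milnor drop)
  obtain ⟨c, hc, hcX⟩ := exists_rsop_adapted E₀
  have hpt : ∀ ξ' ∈ t, 4 ^ sInf {m : ℕ | ∃ (E₀' : AdicCompletion (maximalIdeal (A'.Z.presheaf.stalk ξ'))
        (A'.Z.presheaf.stalk ξ') ≃+* MvPowerSeries (Option (Fin n)) K)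
        (f₀' : A'.Z.presheaf.stalk ξ') (c' : (Fin n → ℕ) → K) (w' : MvPowerSeries (Option (Fin n)) K),
        stalkIdeal (E.transform π D).J ξ' = Ideal.span {f₀'} ∧ IsUnit w' ∧
          E₀' (algebraMap _ _ f₀') = w' * ((X none : MvPowerSeries (Option (Fin n)) K) ^ p -
            rename (some : Fin n → Option (Fin n)) (ser p n K c')) ∧ m = mu p n K c'} ≤ 4 ^ (mu p n K a - 1) := by
    intro ξ' hξ't
    obtain ⟨hξ'S, h⟩ := ht ξ' hξ't
    obtain ⟨i₀, e, τ, E₀', f₀', w', -, -, -, -, hJ', hw', hE'⟩ := exists_canonical_chartDatum_of_eq π D hπ hhom hb hD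
      hd E₀ c hc hcX f₀ a w hJ hw hf₀ hM hord' h hξ'S (hiso' ξ' hξ'S).1
    haveI : IsRegularLocalRing (A'.Z.presheaf.stalk ξ') := ambient_isRegular A' _
    rw [sInf_mu_eq_of_presentation (E.transform π D) ξ' E₀' f₀' _ w' hJ' hw' hE']
    refine Nat.pow_le_pow_right (by norm_num) (Nat.le_sub_one_of_lt ?_)
    have hI' : Isol p n K (step p n K i₀ (fun l => constantCoeff (E₀ (algebraMap _ _ (τ (some l))))) a) :=
      (hiso' ξ' hξ'S).2 E₀' f₀' _ w' hJ' hw' hE'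
    have hM' : MultP p n K (step p n K i₀ (fun l => constantCoeff (E₀ (algebraMap _ _ (τ (some l))))) a) := by
      have hf'𝔪 : f₀' ∈ maximalIdeal (A'.Z.presheaf.stalk ξ') ^ p := by
        have h1 := hξ'S
        change ((E.transform π D).b : ℕ∞) ≤ idealOrder (E.transform π D).J _ at h1
        rw [le_idealOrder_iff, hJ', Ideal.span_singleton_le_iff_mem] at h1
        have hb' : (E.transform π D).b = p := hb
        rw [hb'] at h1
        exact h1
      exact (transform_mem_pow_iff_multP E₀' hw' _ hE').2.mpr ⟨ThreefoldsCharTwo.ser_ne_zero_of_isol hn hI', hf'𝔪⟩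
    exact hmu a i₀ _ hI hM hI' hM'
  -- `μ(a) ≥ 1` since a forced successor exists
  have hmu1 : 1 ≤ mu p n K a := by
    obtain ⟨i, τ, E₀', f₀', w', hJ', hw', hf'⟩ := exists_presentation_transform_of_eq π D hπ hhom hb hD hd E₀ f₀ a w
      hJ hw hf₀ hM hξ₀S (hiso' ξ₀ hξ₀S).1
    haveI : IsRegularLocalRing (A'.Z.presheaf.stalk ξ₀) := ambient_isRegular A' _
    have hI' : Isol p n K (step p n K i τ a) := (hiso' ξ₀ hξ₀S).2 E₀' f₀' _ w' hJ' hw' hf'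
    have hM' : MultP p n K (step p n K i τ a) := by
      have hf'𝔪 : f₀' ∈ maximalIdeal (A'.Z.presheaf.stalk ξ₀) ^ p := by
        have h := hξ₀S
        change ((E.transform π D).b : ℕ∞) ≤ idealOrder (E.transform π D).J _ at h
        rw [le_idealOrder_iff, hJ', Ideal.span_singleton_le_iff_mem] at h
        have hb' : (E.transform π D).b = p := hb
        rw [hb'] at h
        exact h
      exact (transform_mem_pow_iff_multP E₀' hw' _ hf').2.mpr ⟨ThreefoldsCharTwo.ser_ne_zero_of_isol hn hI', hf'𝔪⟩
    exact Nat.one_le_of_lt (hmu a i τ hI hM hI' hM')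
  -- sum up: `Σ ≤ 3 · 4^{μ−1} < 4^μ`
  calc t.sum _ ≤ t.sum (fun _ => 4 ^ (mu p n K a - 1)) := Finset.sum_le_sum hpt
    _ = t.card * 4 ^ (mu p n K a - 1) := by rw [Finset.sum_const, smul_eq_mul]
    _ ≤ 3 * 4 ^ (mu p n K a - 1) := Nat.mul_le_mul_right _ hcard
    _ < 4 * 4 ^ (mu p n K a - 1) := by
        have hX := pow_pos (show 0 < 4 by norm_num) (mu p n K a - 1); omega
    _ = 4 ^ (mu p n K a) := by rw [← pow_succ', Nat.sub_add_cancel hmu1]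

end CampaignW46.ForcedAtom

end Summit.ResolutionOfSingularities.ResolutionOfSingularities.Theorems

end
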